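import Literature.NumberTheory.GelbartRogawski1991.LocalDoubledUnitaryLagrangians
import Literature.NumberTheory.GelbartRogawski1991.DoubledUnitaryAdaptedIwahori
import Literature.NumberTheory.GelbartRogawski1991.LocalDoubledUnitaryUnramifiedParabolic
import Literature.NumberTheory.Automorphic.UnitaryGroupNonsplitPlace
import Literature.NumberTheory.Automorphic.ParabolicGLBigCell
import HarnessLib

-- buildfix G11b-3 recipe (LEDGER B13-1/B13-3): elaborate sequentially so the trailing `attribute [implicit_reducible]`
-- block (reducibilityCoreExt is keyed to the async environment branch) is in force at `.olean` export.
set_option Elab.async false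

/-!
# The Iwahori factorisation `H ∩ K_γ = (P_Δ ∩ K_γ)(N_Δ⁻ ∩ K_γ)` of the doubled unitary group at a non-split place

[cite: MoeglinVignerasWaldspurger1987, Chap. 2 II.8; BernsteinZelevinsky1976, §3.13; Kudla1994, §3]

For `H(F_v) = U(T₀ ⊕ −T₀)(E ⊗ F_v)` at a place `v` of `F` that does not split in `E` (`E ⊗ F_v = E_w` a field),
every `k ∈ H(F_v)` whose `w`-component, conjugated into the `Δ`-adapted frame, lies in a principal congruence
subgroup `K_γ ≤ GL_{n+n}(E_w)` factors INSIDE `H(F_v)` as `k = p · (w_Δ n w_Δ⁻¹)` with `p, n ∈ P_Δ(F_v)` whose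
`w`-components are `K_γ`-elements conjugated by fixed matrices (`exists_factorisation`): the `GL`-Iwahori
factorisation of the tree (`exists_parabolic_mul_lower_of_mem_congruenceGL`) has unitary factors by
`DoubledUnitaryAdaptedIwahori`, and the set of such `k` is a neighbourhood of `1` in `H(F_v)`
(`conjComponent_mem_congruenceGL_mem_nhds`).

* §1 elements of `H(F_v)` with a prescribed (adapted) matrix over `E ⊗ F_v` (`ofMat`, `ofAdapted`), and
  `IsSiegelDelta ↔ C = 0`;
* §2 `E ⊗ F_v ≃+* E_w` at a non-split place (`LocalRing.evalEquiv`) and the transport of matrices;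
* §3 the factorisation and the neighbourhood statement.
-/

set_option autoImplicit false

noncomputable section

open NumberField IsDedekindDomain Matrix
open scoped Topology
open Literature.NumberTheory.Automorphic Literature.NumberTheory.Automorphic.UnitaryGroup
open Literature.NumberTheory.GelbartRogawski1991.AdaptedBlocks

namespace Literature.NumberTheory.GelbartRogawski1991.UnitaryDualPair.LocalSplitting

variable (F : Type) [Field F] [NumberField F] (E : Type) [Field E] [NumberField E] [Algebra F E] (c : E ≃ₐ[F] E)
  {δ : E} (hcδ : c δ = -δ) (hδ : δ ≠ 0) {d : F} (hd : δ * δ = algebraMap F E d)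
  (v : HeightOneSpectrum (𝓞 F)) (n : ℕ) {T₀ : Matrix (Fin n) (Fin n) F} (hT₀ : T₀.IsSymm) (hT₀d : IsUnit T₀.det)
  {JD : Matrix (Fin (n + n)) (Fin (n + n)) E} (hJD : JD = (gramD F n T₀).map (algebraMap F E))

/-! ## §1 Elements of `H(F_v)` with prescribed matrix -/

include hJD in
/-- a unitary invertible matrix over `E ⊗ F_v` (for `T₀ ⊕ −T₀`, in `e₂`-coordinates) re-enumerated is in `U(J^𝔻)(F_v)`.
[cite: Kudla1994, §3] -/
theorem reindex_mem_local {M : Matrix (Fin n ⊕ Fin n) (Fin n ⊕ Fin n) (LocalRing E v)}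
    (hMu : IsUnit (Matrix.reindex (e₂ n) (e₂ n) M).det)
    (hM : (M.map (conjLocal E c v))ᵀ * Matrix.fromBlocks (gramS F E v n T₀) 0 0 (-gramS F E v n T₀) * M =
      Matrix.fromBlocks (gramS F E v n T₀) 0 0 (-gramS F E v n T₀)) :
    ((Matrix.isUnit_iff_isUnit_det _).2 hMu).unit ∈ UnitaryGroup.local E c (n + n) JD v := by
  rw [UnitaryGroup.local, mem_unitaryGroupOfForm_iff, localFormD_eq F E v n hJD, IsUnit.unit_spec]
  have ht : ((Matrix.reindex (e₂ n) (e₂ n) M).map (conjLocal E c v))ᵀ =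
      Matrix.reindex (e₂ n) (e₂ n) ((M.map (conjLocal E c v))ᵀ) := by
    rw [Matrix.reindex_apply, Matrix.reindex_apply, ← Matrix.submatrix_map, Matrix.transpose_submatrix]
  rw [ht, Matrix.reindex_apply, Matrix.reindex_apply, Matrix.reindex_apply, Matrix.submatrix_mul_equiv,
    Matrix.submatrix_mul_equiv, hM]

include hJD in
/-- **the element of `H(F_v)` with matrix `M`** over `E ⊗ F_v` (`M` unitary for `T₀ ⊕ −T₀` and invertible).
[cite: Kudla1994, §3] -/
def ofMat (M : Matrix (Fin n ⊕ Fin n) (Fin n ⊕ Fin n) (LocalRing E v)) (hMu : IsUnit M.det)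
    (hM : (M.map (conjLocal E c v))ᵀ * Matrix.fromBlocks (gramS F E v n T₀) 0 0 (-gramS F E v n T₀) * M =
      Matrix.fromBlocks (gramS F E v n T₀) 0 0 (-gramS F E v n T₀)) :
    UnitaryGroup.localPi E c (n + n) JD v :=
  have hMu' : IsUnit (Matrix.reindex (e₂ n) (e₂ n) M).det := by rw [Matrix.det_reindex_self]; exact hMu
  (localPiEquiv E c (n + n) JD v).symm
    ⟨((Matrix.isUnit_iff_isUnit_det _).2 hMu').unit, reindex_mem_local F E c v n hJD hMu' hM⟩

include hJD in
/-- `matA (ofMat M) = M`. [cite: Kudla1994, §3] -/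
theorem matA_ofMat (M : Matrix (Fin n ⊕ Fin n) (Fin n ⊕ Fin n) (LocalRing E v)) (hMu : IsUnit M.det)
    (hM : (M.map (conjLocal E c v))ᵀ * Matrix.fromBlocks (gramS F E v n T₀) 0 0 (-gramS F E v n T₀) * M =
      Matrix.fromBlocks (gramS F E v n T₀) 0 0 (-gramS F E v n T₀)) :
    matA F E c v n (ofMat F E c v n hJD M hMu hM) = M := by
  rw [matA, matS, ofMat, (localPiEquiv E c (n + n) JD v).apply_symm_apply]
  change Matrix.reindex (e₂ n).symm (e₂ n).symm (Matrix.reindex (e₂ n) (e₂ n) M) = M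
  rw [Matrix.reindex_apply, Matrix.reindex_apply, Matrix.submatrix_submatrix, Equiv.symm_symm, Equiv.symm_comp_self,
    Matrix.submatrix_id_id]

/-- the `w`-component of `g ∈ H(F_v)` is the `w`-component of its matrix over `E ⊗ F_v`. [cite: Kudla1994, §3] -/
theorem coe_component_eq_matS_map (g : UnitaryGroup.localPi E c (n + n) JD v) (w : PlacesOver E v) :
    (((g : UnitaryGroup.LocalGLPi E (n + n) v) w : GL (Fin (n + n)) (w.1.adicCompletion E)) :
        Matrix (Fin (n + n)) (Fin (n + n)) (w.1.adicCompletion E)) = (matS F E c v n g).map (Pi.evalRingHom _ w) := by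
  rw [matS, coe_localPiEquiv_apply]
  exact (GLn.map_piEquiv_symm _ _ _ w).symm

include hJD in
/-- `matS (ofMat M) = reindex M`. [cite: Kudla1994, §3] -/
theorem matS_ofMat (M : Matrix (Fin n ⊕ Fin n) (Fin n ⊕ Fin n) (LocalRing E v)) (hMu : IsUnit M.det)
    (hM : (M.map (conjLocal E c v))ᵀ * Matrix.fromBlocks (gramS F E v n T₀) 0 0 (-gramS F E v n T₀) * M =
      Matrix.fromBlocks (gramS F E v n T₀) 0 0 (-gramS F E v n T₀)) :
    matS F E c v n (ofMat F E c v n hJD M hMu hM) = Matrix.reindex (e₂ n) (e₂ n) M := by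
  rw [matS, ofMat, (localPiEquiv E c (n + n) JD v).apply_symm_apply]
  rfl

include hJD in
/-- the `w`-component of `ofMat M` is the re-enumerated `w`-component of `M`. [cite: Kudla1994, §3] -/
theorem coe_ofMat_apply (M : Matrix (Fin n ⊕ Fin n) (Fin n ⊕ Fin n) (LocalRing E v)) (hMu : IsUnit M.det)
    (hM : (M.map (conjLocal E c v))ᵀ * Matrix.fromBlocks (gramS F E v n T₀) 0 0 (-gramS F E v n T₀) * M =
      Matrix.fromBlocks (gramS F E v n T₀) 0 0 (-gramS F E v n T₀)) (w : PlacesOver E v) :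
    (((ofMat F E c v n hJD M hMu hM : UnitaryGroup.LocalGLPi E (n + n) v) w : GL (Fin (n + n)) (w.1.adicCompletion E)) :
        Matrix (Fin (n + n)) (Fin (n + n)) (w.1.adicCompletion E)) =
      (Matrix.reindex (e₂ n) (e₂ n) M).map (Pi.evalRingHom _ w) := by
  rw [coe_component_eq_matS_map, matS_ofMat]

/-- the matrix over `E ⊗ F_v` determines the element: `matA` is injective. [cite: Kudla1994, §3] -/
theorem matA_injective : Function.Injective (matA F E c v n (JD := JD)) := by
  intro g h hgh
  apply (localPiEquiv E c (n + n) JD v).injective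
  apply Subtype.ext
  apply Units.ext
  have := congrArg (Matrix.reindex (e₂ n) (e₂ n)) hgh
  simpa only [matA, Matrix.reindex_apply, Matrix.submatrix_submatrix, Equiv.symm_symm, Equiv.self_comp_symm,
    Matrix.submatrix_id_id] using this

variable [Algebra.IsQuadraticExtension F E] in
include hcδ hδ hd hT₀ hJD in
/-- **`P_Δ = {C = 0}`** over `E ⊗ F_v`. [cite: Kudla1994, §3; HarrisKudlaSweet1996, §1 (1.11)] -/
theorem isSiegelDelta_iff_blkC_eq_zero (p : UnitaryGroup.localPi E c (n + n) JD v) :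
    IsSiegelDelta F E c hcδ hδ hd v n hT₀ hJD p ↔ blkC (matA F E c v n p) = 0 := by
  rw [isSiegelDelta_iff_blocks, blkC_eq_zero_iff, matA, blocks_eq_iff_forall_place]
  refine forall_congr' fun w => ?_
  rw [coe_component_eq_matS_map]

/-- the adapted hermitian form `antidiag(2T₀, 2T₀)` over `E ⊗ F_v`. [cite: HarrisKudlaSweet1996, §1 (1.11)] -/
abbrev adForm : Matrix (Fin n ⊕ Fin n) (Fin n ⊕ Fin n) (LocalRing E v) :=
  Matrix.fromBlocks 0 ((2 : LocalRing E v) • gramS F E v n T₀) ((2 : LocalRing E v) • gramS F E v n T₀) 0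

include hJD in
/-- **the element of `H(F_v)` with ADAPTED matrix `Y`** (`Y` preserving `antidiag(2T₀, 2T₀)`, invertible): its matrix
is `R Y R⁻¹`. [cite: Kudla1994, §3; HarrisKudlaSweet1996, §1 (1.11)] -/
def ofAdapted (Y : Matrix (Fin n ⊕ Fin n) (Fin n ⊕ Fin n) (LocalRing E v)) (hYu : IsUnit Y.det)
    (hY : (Y.map (conjLocal E c v))ᵀ * adForm F E v n (T₀ := T₀) * Y = adForm F E v n (T₀ := T₀)) :
    UnitaryGroup.localPi E c (n + n) JD v :=
  ofMat F E c v n hJD (cayR (LocalRing E v) (Fin n) * Y * cayRinv (LocalRing E v) (Fin n))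
    (by
      rw [Matrix.det_mul, Matrix.det_mul, mul_comm (cayR _ _).det, mul_assoc, ← Matrix.det_mul, cayR_mul_cayRinv,
        Matrix.det_one, mul_one]
      exact hYu)
    (cstar_mul_diag_mul_of_conj hY)

include hJD in
/-- `matA (ofAdapted Y) = R Y R⁻¹`. [cite: Kudla1994, §3] -/
theorem matA_ofAdapted (Y : Matrix (Fin n ⊕ Fin n) (Fin n ⊕ Fin n) (LocalRing E v)) (hYu : IsUnit Y.det)
    (hY : (Y.map (conjLocal E c v))ᵀ * adForm F E v n (T₀ := T₀) * Y = adForm F E v n (T₀ := T₀)) :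
    matA F E c v n (ofAdapted F E c v n hJD Y hYu hY) = cayR (LocalRing E v) (Fin n) * Y * cayRinv (LocalRing E v) (Fin n) :=
  matA_ofMat F E c v n hJD _ _ _

include hJD in
/-- `adapt (matA (ofAdapted Y)) = Y`. [cite: Kudla1994, §3] -/
theorem adapt_matA_ofAdapted (Y : Matrix (Fin n ⊕ Fin n) (Fin n ⊕ Fin n) (LocalRing E v)) (hYu : IsUnit Y.det)
    (hY : (Y.map (conjLocal E c v))ᵀ * adForm F E v n (T₀ := T₀) * Y = adForm F E v n (T₀ := T₀)) :
    adapt (matA F E c v n (ofAdapted F E c v n hJD Y hYu hY)) = Y := by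
  rw [matA_ofAdapted, adapt_conj]

/-- `C(M)` is the `(2,1)` block of `adapt M`. [cite: Kudla1994, §3] -/
theorem blkC_eq_toBlocks₂₁_adapt (M : Matrix (Fin n ⊕ Fin n) (Fin n ⊕ Fin n) (LocalRing E v)) :
    blkC M = (adapt M).toBlocks₂₁ := by
  rw [adapt_eq, Matrix.toBlocks_fromBlocks₂₁]

variable [Algebra.IsQuadraticExtension F E] in
include hcδ hδ hd hT₀ hJD in
/-- an element with block-upper-triangular adapted matrix lies in `P_Δ`. [cite: Kudla1994, §3] -/
theorem isSiegelDelta_ofAdapted_fromBlocks (A B D : Matrix (Fin n) (Fin n) (LocalRing E v))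
    (hYu : IsUnit (Matrix.fromBlocks A B 0 D).det)
    (hY : ((Matrix.fromBlocks A B 0 D).map (conjLocal E c v))ᵀ * adForm F E v n (T₀ := T₀) * Matrix.fromBlocks A B 0 D =
      adForm F E v n (T₀ := T₀)) :
    IsSiegelDelta F E c hcδ hδ hd v n hT₀ hJD (ofAdapted F E c v n hJD _ hYu hY) := by
  rw [isSiegelDelta_iff_blkC_eq_zero, blkC_eq_toBlocks₂₁_adapt, adapt_matA_ofAdapted, Matrix.toBlocks_fromBlocks₂₁]

/-! ## §2 `E ⊗ F_v = E_w` at a non-split place, and the transport of matrices -/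

variable [Algebra.IsQuadraticExtension F E] in
/-- **`E ⊗ F_v ≃+* E_w` at a non-split place**: evaluation at the unique place `w ∣ v`.
[cite: CasselsFrohlichANT1967, Ch. II §10] -/
def LocalRing.evalEquiv (hc : c ≠ 1) (w : PlacesOver E v) (hw : c • w.1 = w.1) : LocalRing E v ≃+* w.1.adicCompletion E := by
  classical
  exact RingEquiv.ofBijective (Pi.evalRingHom (fun w' : PlacesOver E v => w'.1.adicCompletion E) w)
    ⟨fun x y h => (LocalRing.eq_iff_apply_eq c hc w hw x y).2 h,
     fun x => ⟨Function.update (0 : LocalRing E v) w x, by simp⟩⟩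

variable [Algebra.IsQuadraticExtension F E] in
/-- unfolding: `evalEquiv w x = x w`. [cite: CasselsFrohlichANT1967, Ch. II §10] -/
@[simp] theorem LocalRing.evalEquiv_apply (hc : c ≠ 1) (w : PlacesOver E v) (hw : c • w.1 = w.1) (x : LocalRing E v) :
    LocalRing.evalEquiv F E c v hc w hw x = x w := rfl

variable [Algebra.IsQuadraticExtension F E] in
/-- `evalEquiv` as a ring hom is evaluation. [cite: CasselsFrohlichANT1967, Ch. II §10] -/
theorem LocalRing.coe_evalEquiv (hc : c ≠ 1) (w : PlacesOver E v) (hw : c • w.1 = w.1) :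
    (LocalRing.evalEquiv F E c v hc w hw : LocalRing E v →+* w.1.adicCompletion E) =
      Pi.evalRingHom (fun w' : PlacesOver E v => w'.1.adicCompletion E) w := rfl

/-! ## §3 The Weyl element `w_Δ`, the change of frame at `w`, and the factorisation -/

omit [NumberField F] in
/-- `det s` is a unit (`s² = 1`). [cite: Kudla1994, §3] -/
theorem isUnit_det_weylAd :
    IsUnit (Matrix.fromBlocks (0 : Matrix (Fin n) (Fin n) (LocalRing E v)) (1 : Matrix (Fin n) (Fin n) (LocalRing E v))
      (1 : Matrix (Fin n) (Fin n) (LocalRing E v)) 0).det :=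
  IsUnit.of_mul_eq_one _ (by rw [← Matrix.det_mul, weylAd_mul_weylAd, Matrix.det_one])

include hJD in
/-- **the Weyl element `w_Δ ∈ H(F_v)`**: adapted matrix `s = [[0, 1], [1, 0]]` (it swaps `Δ` and `Δ⁻`).
[cite: Kudla1994, §3; Weil1964, n° 32] -/
def weylDelta : UnitaryGroup.localPi E c (n + n) JD v :=
  ofAdapted F E c v n hJD (Matrix.fromBlocks 0 1 1 0) (isUnit_det_weylAd F E v n) (cstar_weylAd (conjLocal E c v) _)

include hJD in
/-- `w_Δ² = 1`. [cite: Kudla1994, §3] -/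
theorem weylDelta_mul_self : weylDelta F E c v n hJD (T₀ := T₀) * weylDelta F E c v n hJD = 1 := by
  apply matA_injective F E c v n
  rw [← matA_mul, matA_one, weylDelta, matA_ofAdapted]
  calc cayR _ _ * Matrix.fromBlocks 0 1 1 0 * cayRinv _ _ * (cayR _ _ * Matrix.fromBlocks 0 1 1 0 * cayRinv _ _)
      = cayR (LocalRing E v) (Fin n) * (Matrix.fromBlocks 0 1 1 0 * (cayRinv _ _ * cayR _ _) * Matrix.fromBlocks 0 1 1 0) *
          cayRinv (LocalRing E v) (Fin n) := by simp only [Matrix.mul_assoc]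
    _ = 1 := by rw [cayRinv_mul_cayR, Matrix.mul_one, weylAd_mul_weylAd, Matrix.mul_one, cayR_mul_cayRinv]

include hJD in
/-- `w_Δ⁻¹ = w_Δ`. [cite: Kudla1994, §3] -/
theorem weylDelta_inv : (weylDelta F E c v n hJD (T₀ := T₀))⁻¹ = weylDelta F E c v n hJD :=
  inv_eq_of_mul_eq_one_right (weylDelta_mul_self F E c v n hJD)

/-- the re-enumerated Cayley matrix `R` as an element of `GL_{n+n}(E ⊗ F_v)`. [cite: HarrisKudlaSweet1996, §1 (1.11)] -/
def cayGL : GL (Fin (n + n)) (LocalRing E v) :=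
  ⟨Matrix.reindex (e₂ n) (e₂ n) (cayR (LocalRing E v) (Fin n)), Matrix.reindex (e₂ n) (e₂ n) (cayRinv (LocalRing E v) (Fin n)),
    by rw [Matrix.reindex_apply, Matrix.reindex_apply, Matrix.submatrix_mul_equiv, cayR_mul_cayRinv, Matrix.submatrix_one_equiv],
    by rw [Matrix.reindex_apply, Matrix.reindex_apply, Matrix.submatrix_mul_equiv, cayRinv_mul_cayR, Matrix.submatrix_one_equiv]⟩

/-- the re-enumerated `s` as an element of `GL_{n+n}(E ⊗ F_v)`. [cite: Kudla1994, §3] -/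
def weylGL : GL (Fin (n + n)) (LocalRing E v) :=
  ⟨Matrix.reindex (e₂ n) (e₂ n) (Matrix.fromBlocks (0 : Matrix (Fin n) (Fin n) (LocalRing E v)) 1 1 0),
    Matrix.reindex (e₂ n) (e₂ n) (Matrix.fromBlocks (0 : Matrix (Fin n) (Fin n) (LocalRing E v)) 1 1 0),
    by rw [Matrix.reindex_apply, Matrix.submatrix_mul_equiv, weylAd_mul_weylAd, Matrix.submatrix_one_equiv],
    by rw [Matrix.reindex_apply, Matrix.submatrix_mul_equiv, weylAd_mul_weylAd, Matrix.submatrix_one_equiv]⟩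

/-- the `w`-component map `GL_{n+n}(E ⊗ F_v) → GL_{n+n}(E_w)`. [cite: Kudla1994, §3] -/
abbrev toGLw (w : PlacesOver E v) : GL (Fin (n + n)) (LocalRing E v) →* GL (Fin (n + n)) (w.1.adicCompletion E) :=
  Units.map (RingHom.mapMatrix (Pi.evalRingHom (fun w' : PlacesOver E v => w'.1.adicCompletion E) w)).toMonoidHom

/-- **the `w`-component of `k` in the adapted frame**: `R⁻¹ k_w R ∈ GL_{n+n}(E_w)`. [cite: Kudla1994, §3] -/
def adComp (w : PlacesOver E v) (k : UnitaryGroup.localPi E c (n + n) JD v) : GL (Fin (n + n)) (w.1.adicCompletion E) :=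
  (toGLw F E v n w (cayGL F E v n))⁻¹ * (k : UnitaryGroup.LocalGLPi E (n + n) v) w * toGLw F E v n w (cayGL F E v n)

omit [NumberField F] in
/-- re-enumeration is multiplicative. [cite: Kudla1994, §3] -/
private theorem reindex_mul (M N : Matrix (Fin n ⊕ Fin n) (Fin n ⊕ Fin n) (LocalRing E v)) :
    Matrix.reindex (e₂ n) (e₂ n) (M * N) = Matrix.reindex (e₂ n) (e₂ n) M * Matrix.reindex (e₂ n) (e₂ n) N := by
  rw [Matrix.reindex_apply, Matrix.reindex_apply, Matrix.reindex_apply, Matrix.submatrix_mul_equiv]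

/-- `matS = reindex matA`. [cite: Kudla1994, §3] -/
theorem reindex_matA (k : UnitaryGroup.localPi E c (n + n) JD v) :
    Matrix.reindex (e₂ n) (e₂ n) (matA F E c v n k) = matS F E c v n k := by
  rw [matA, Matrix.reindex_apply, Matrix.reindex_apply, Matrix.submatrix_submatrix, Equiv.symm_symm, Equiv.self_comp_symm,
    Matrix.submatrix_id_id]

/-- `R⁻¹ k_w R = (adapt (matA k))_w`, entrywise. [cite: Kudla1994, §3] -/
theorem coe_adComp (w : PlacesOver E v) (k : UnitaryGroup.localPi E c (n + n) JD v) :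
    ((adComp F E c v n w k : GL (Fin (n + n)) (w.1.adicCompletion E)) : Matrix (Fin (n + n)) (Fin (n + n)) (w.1.adicCompletion E)) =
      (Matrix.reindex (e₂ n) (e₂ n) (adapt (matA F E c v n k))).map (Pi.evalRingHom _ w) := by
  change (Matrix.reindex (e₂ n) (e₂ n) (cayRinv (LocalRing E v) (Fin n))).map
      (Pi.evalRingHom (fun w' : PlacesOver E v => w'.1.adicCompletion E) w) * _ *
    (Matrix.reindex (e₂ n) (e₂ n) (cayR (LocalRing E v) (Fin n))).map
      (Pi.evalRingHom (fun w' : PlacesOver E v => w'.1.adicCompletion E) w) = _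
  rw [coe_component_eq_matS_map, ← Matrix.map_mul, ← Matrix.map_mul, ← reindex_matA, ← reindex_mul, ← reindex_mul, adapt]

/-- `k ↦ R⁻¹ k_w R` is continuous. [cite: MoeglinVignerasWaldspurger1987, Chap. 2 II.8] -/
theorem continuous_adComp (w : PlacesOver E v) : Continuous (adComp F E c v n w (JD := JD)) :=
  (continuous_const.mul ((continuous_apply w).comp continuous_subtype_val)).mul continuous_const

/-- `R⁻¹ 1_w R = 1`. [cite: Kudla1994, §3] -/
theorem adComp_one (w : PlacesOver E v) : adComp F E c v n w (1 : UnitaryGroup.localPi E c (n + n) JD v) = 1 := by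
  rw [adComp, OneMemClass.coe_one, Pi.one_apply, mul_one, inv_mul_cancel]

/-- **`{k : R⁻¹ k_w R ∈ K_γ}` is a neighbourhood of `1` in `H(F_v)`** (`γ ≠ 0`).
[cite: MoeglinVignerasWaldspurger1987, Chap. 2 II.8] -/
theorem adComp_mem_congruenceGL_mem_nhds (w : PlacesOver E v) {γ : ValuativeRel.ValueGroupWithZero (w.1.adicCompletion E)}
    (hγ : γ ≠ 0) :
    {k : UnitaryGroup.localPi E c (n + n) JD v | adComp F E c v n w k ∈ congruenceGL (n + n) γ} ∈ 𝓝 1 :=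
  ((isOpen_congruenceGL hγ).preimage (continuous_adComp F E c v n w)).mem_nhds
    (by rw [Set.mem_preimage, adComp_one]; exact Subgroup.one_mem _)

/-- the two-block labelling of `Fin (n + n)` (`0` on the `Δ`-half, `1` on the `Δ⁻`-half).
[cite: BernsteinZelevinsky1976, §3.13] -/
def lab : Fin (n + n) → Fin 2 := fun i => Sum.elim (fun _ => 0) (fun _ => 1) ((e₂ n).symm i)

omit [NumberField F] in
/-- `lab (e₂ (inl i)) = 0`. [cite: BernsteinZelevinsky1976, §3.13] -/
@[simp] theorem lab_inl (i : Fin n) : lab n (e₂ n (Sum.inl i)) = 0 := by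
  simp only [lab, Equiv.symm_apply_apply, Sum.elim_inl]

omit [NumberField F] in
/-- `lab (e₂ (inr i)) = 1`. [cite: BernsteinZelevinsky1976, §3.13] -/
@[simp] theorem lab_inr (i : Fin n) : lab n (e₂ n (Sum.inr i)) = 1 := by
  simp only [lab, Equiv.symm_apply_apply, Sum.elim_inr]

/-- `s · [[1,X],[0,1]] · s = [[1,0],[X,1]]`. [cite: Kudla1994, §3] -/
theorem weylAd_mul_upperUnip_mul_weylAd {L : Type*} [CommRing L] (X : Matrix (Fin n) (Fin n) L) :
    Matrix.fromBlocks (0 : Matrix (Fin n) (Fin n) L) (1 : Matrix (Fin n) (Fin n) L) (1 : Matrix (Fin n) (Fin n) L) 0 *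
        Matrix.fromBlocks 1 X 0 1 * Matrix.fromBlocks (0 : Matrix (Fin n) (Fin n) L) (1 : Matrix (Fin n) (Fin n) L) (1 : Matrix (Fin n) (Fin n) L) 0 =
      Matrix.fromBlocks 1 0 X 1 := by
  rw [Matrix.fromBlocks_multiply, Matrix.fromBlocks_multiply]; simp

/-- block shape of a `lab`-block-upper-triangular matrix after re-enumeration: the `(2,1)` block vanishes.
[cite: BernsteinZelevinsky1976, §3.13] -/
theorem toBlocks₂₁_eq_zero_of_blockTriangular {K : Type*} [Zero K] {M : Matrix (Fin (n + n)) (Fin (n + n)) K}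
    (hM : M.BlockTriangular (lab n)) : (Matrix.reindex (e₂ n).symm (e₂ n).symm M).toBlocks₂₁ = 0 := by
  ext i j
  simp only [Matrix.toBlocks₂₁, Matrix.reindex_apply, Equiv.symm_symm, Matrix.submatrix_apply, Matrix.of_apply,
    Matrix.zero_apply]
  exact hM (by rw [lab_inl, lab_inr]; exact Fin.zero_lt_one)

/-- block shape of a `lab`-block-LOWER-unitriangular matrix after re-enumeration: `[[1, 0], [X, 1]]`.
[cite: BernsteinZelevinsky1976, §3.13] -/
theorem reindex_eq_fromBlocks_of_mem_unipotentRadicalGL {K : Type*} [CommRing K] {u : GL (Fin (n + n)) K}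
    (hu : u ∈ unipotentRadicalGL K (⇑OrderDual.toDual ∘ lab n)) :
    Matrix.reindex (e₂ n).symm (e₂ n).symm (u : Matrix (Fin (n + n)) (Fin (n + n)) K) =
      Matrix.fromBlocks 1 0 ((Matrix.reindex (e₂ n).symm (e₂ n).symm (u : Matrix (Fin (n + n)) (Fin (n + n)) K)).toBlocks₂₁) 1 := by
  have h := (mem_unipotentRadicalGL_iff_apply (c := ⇑OrderDual.toDual ∘ lab n) u).1 hu
  have h1 : ∀ x y : Fin n ⊕ Fin n, lab n (e₂ n x) ≤ lab n (e₂ n y) →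
      (u : Matrix (Fin (n + n)) (Fin (n + n)) K) (e₂ n x) (e₂ n y) = if x = y then 1 else 0 := by
    intro x y hxy
    rw [h (e₂ n x) (e₂ n y) (by simpa using hxy)]
    simp only [Matrix.one_apply, EmbeddingLike.apply_eq_iff_eq]
  rw [← Matrix.fromBlocks_toBlocks (Matrix.reindex (e₂ n).symm (e₂ n).symm (u : Matrix (Fin (n + n)) (Fin (n + n)) K))]
  congr 1
  · ext i j
    simp only [Matrix.toBlocks₁₁, Matrix.reindex_apply, Equiv.symm_symm, Matrix.submatrix_apply, Matrix.of_apply]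
    rw [h1 _ _ (by rw [lab_inl, lab_inl])]
    simp only [Matrix.one_apply, Sum.inl.injEq]
  · ext i j
    simp only [Matrix.toBlocks₁₂, Matrix.reindex_apply, Equiv.symm_symm, Matrix.submatrix_apply, Matrix.of_apply,
      Matrix.zero_apply]
    rw [h1 _ _ (by rw [lab_inl, lab_inr]; exact Fin.zero_le _), if_neg Sum.inl_ne_inr]
  · ext i j
    simp only [Matrix.toBlocks₂₂, Matrix.reindex_apply, Equiv.symm_symm, Matrix.submatrix_apply, Matrix.of_apply]
    rw [h1 _ _ (by rw [lab_inr, lab_inr])]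
    simp only [Matrix.one_apply, Sum.inr.injEq]

include hJD in
/-- the `w`-component of `ofAdapted Y` is `R · Y_w · R⁻¹`. [cite: Kudla1994, §3] -/
theorem coe_ofAdapted_apply (Y : Matrix (Fin n ⊕ Fin n) (Fin n ⊕ Fin n) (LocalRing E v)) (hYu : IsUnit Y.det)
    (hY : (Y.map (conjLocal E c v))ᵀ * adForm F E v n (T₀ := T₀) * Y = adForm F E v n (T₀ := T₀)) (w : PlacesOver E v) :
    (((ofAdapted F E c v n hJD Y hYu hY : UnitaryGroup.LocalGLPi E (n + n) v) w : GL (Fin (n + n)) (w.1.adicCompletion E)) :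
        Matrix (Fin (n + n)) (Fin (n + n)) (w.1.adicCompletion E)) =
      (toGLw F E v n w (cayGL F E v n) : Matrix (Fin (n + n)) (Fin (n + n)) (w.1.adicCompletion E)) *
        (Matrix.reindex (e₂ n) (e₂ n) Y).map (Pi.evalRingHom _ w) *
        ((toGLw F E v n w (cayGL F E v n))⁻¹ : GL (Fin (n + n)) (w.1.adicCompletion E)) := by
  rw [ofAdapted, coe_ofMat_apply, reindex_mul, reindex_mul, Matrix.map_mul, Matrix.map_mul]
  rfl

variable [Algebra.IsQuadraticExtension F E] in
include hcδ hδ hd hT₀ hJD in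
/-- **THE IWAHORI FACTORISATION INSIDE `H(F_v)`** at a non-split place: if `R⁻¹ k_w R` lies in the congruence
subgroup `K_γ` (`γ < 1`) of `GL_{n+n}(E_w)`, then `k = p · (w_Δ u w_Δ⁻¹)` with `p, u ∈ P_Δ(F_v)` and
`p_w = R p' R⁻¹`, `u_w = (R s) u' (R s)⁻¹` for some `p', u' ∈ K_γ`.
[cite: MoeglinVignerasWaldspurger1987, Chap. 2 II.8; BernsteinZelevinsky1976, §3.13] -/
theorem exists_factorisation (w : PlacesOver E v) (hw : c • w.1 = w.1)
    {γ : ValuativeRel.ValueGroupWithZero (w.1.adicCompletion E)} (hγ : γ < 1)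
    (k : UnitaryGroup.localPi E c (n + n) JD v) (hk : adComp F E c v n w k ∈ congruenceGL (n + n) γ) :
    ∃ p u : UnitaryGroup.localPi E c (n + n) JD v,
      k = p * (weylDelta F E c v n hJD * u * (weylDelta F E c v n hJD)⁻¹) ∧
      IsSiegelDelta F E c hcδ hδ hd v n hT₀ hJD p ∧ IsSiegelDelta F E c hcδ hδ hd v n hT₀ hJD u ∧
      (∃ p' ∈ congruenceGL (n + n) γ,
        (p : UnitaryGroup.LocalGLPi E (n + n) v) w = toGLw F E v n w (cayGL F E v n) * p' * (toGLw F E v n w (cayGL F E v n))⁻¹) ∧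
      (∃ u' ∈ congruenceGL (n + n) γ,
        (u : UnitaryGroup.LocalGLPi E (n + n) v) w =
          toGLw F E v n w (cayGL F E v n) * toGLw F E v n w (weylGL F E v n) * u' *
            (toGLw F E v n w (cayGL F E v n) * toGLw F E v n w (weylGL F E v n))⁻¹) := by
  classical
  obtain ⟨p', hp'P, hp'K, u', hu'U, hu'K, hfac⟩ := exists_parabolic_mul_lower_of_mem_congruenceGL (lab n) hγ hk
  have hc : c ≠ 1 := galConj_ne_one_of_delta F E c hcδ hδ
  -- `E ⊗ F_v ≃ E_w`
  set π : LocalRing E v ≃+* w.1.adicCompletion E := LocalRing.evalEquiv F E c v hc w hw with hπ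
  have hπe : ∀ x, Pi.evalRingHom (fun w' : PlacesOver E v => w'.1.adicCompletion E) w x = π x := fun _ => rfl
  have hback : ∀ Z : Matrix (Fin n ⊕ Fin n) (Fin n ⊕ Fin n) (w.1.adicCompletion E),
      (Z.map π.symm).map (Pi.evalRingHom (fun w' : PlacesOver E v => w'.1.adicCompletion E) w) = Z := by
    intro Z; ext i j; simp only [Matrix.map_apply, hπe, RingEquiv.apply_symm_apply]
  have hinj : Function.Injective fun Z : Matrix (Fin n ⊕ Fin n) (Fin n ⊕ Fin n) (LocalRing E v) =>
      Z.map (Pi.evalRingHom (fun w' : PlacesOver E v => w'.1.adicCompletion E) w) :=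
    Matrix.map_injective π.injective
  -- the pulled-back factors over `E ⊗ F_v`
  set P : Matrix (Fin n ⊕ Fin n) (Fin n ⊕ Fin n) (LocalRing E v) :=
    (Matrix.reindex (e₂ n).symm (e₂ n).symm (p' : Matrix (Fin (n + n)) (Fin (n + n)) (w.1.adicCompletion E))).map π.symm
    with hP
  set U : Matrix (Fin n ⊕ Fin n) (Fin n ⊕ Fin n) (LocalRing E v) :=
    (Matrix.reindex (e₂ n).symm (e₂ n).symm (u' : Matrix (Fin (n + n)) (Fin (n + n)) (w.1.adicCompletion E))).map π.symm
    with hU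
  have hPπ : P.map (Pi.evalRingHom (fun w' : PlacesOver E v => w'.1.adicCompletion E) w) =
      Matrix.reindex (e₂ n).symm (e₂ n).symm (p' : Matrix (Fin (n + n)) (Fin (n + n)) (w.1.adicCompletion E)) := hback _
  have hUπ : U.map (Pi.evalRingHom (fun w' : PlacesOver E v => w'.1.adicCompletion E) w) =
      Matrix.reindex (e₂ n).symm (e₂ n).symm (u' : Matrix (Fin (n + n)) (Fin (n + n)) (w.1.adicCompletion E)) := hback _
  -- the `w`-components of the re-enumerated factors
  have hPw : (Matrix.reindex (e₂ n) (e₂ n) P).map (Pi.evalRingHom (fun w' : PlacesOver E v => w'.1.adicCompletion E) w) =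
      (p' : Matrix (Fin (n + n)) (Fin (n + n)) (w.1.adicCompletion E)) := by
    rw [Matrix.reindex_apply, ← Matrix.submatrix_map, hPπ, Matrix.reindex_apply, Matrix.submatrix_submatrix, Equiv.symm_symm,
      Equiv.self_comp_symm, Matrix.submatrix_id_id]
  have hUw : (Matrix.reindex (e₂ n) (e₂ n) U).map (Pi.evalRingHom (fun w' : PlacesOver E v => w'.1.adicCompletion E) w) =
      (u' : Matrix (Fin (n + n)) (Fin (n + n)) (w.1.adicCompletion E)) := by
    rw [Matrix.reindex_apply, ← Matrix.submatrix_map, hUπ, Matrix.reindex_apply, Matrix.submatrix_submatrix, Equiv.symm_symm,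
      Equiv.self_comp_symm, Matrix.submatrix_id_id]
  -- shapes
  set A := P.toBlocks₁₁ with hA
  set B := P.toBlocks₁₂ with hB
  set D := P.toBlocks₂₂ with hD
  set X := U.toBlocks₂₁ with hX
  have hPshape : P = Matrix.fromBlocks A B 0 D := by
    have h21 : P.toBlocks₂₁ = 0 := by
      have h0 := toBlocks₂₁_eq_zero_of_blockTriangular n (K := w.1.adicCompletion E) hp'P
      rw [hP]
      ext i j
      have := congrFun (congrFun h0 i) j
      simp only [Matrix.toBlocks₂₁, Matrix.of_apply, Matrix.zero_apply] at this
      simp only [Matrix.toBlocks₂₁, Matrix.map_apply, Matrix.of_apply, Matrix.zero_apply, this, map_zero]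
    conv_lhs => rw [← Matrix.fromBlocks_toBlocks P, h21]
  have hUshape : U = Matrix.fromBlocks 1 0 X 1 := by
    have h0 := reindex_eq_fromBlocks_of_mem_unipotentRadicalGL n hu'U
    have hU' : U = (Matrix.fromBlocks 1 0
        ((Matrix.reindex (e₂ n).symm (e₂ n).symm (u' : Matrix (Fin (n + n)) (Fin (n + n)) (w.1.adicCompletion E))).toBlocks₂₁) 1).map
        π.symm := by rw [hU, ← h0]
    have hX' : X = ((Matrix.reindex (e₂ n).symm (e₂ n).symm
        (u' : Matrix (Fin (n + n)) (Fin (n + n)) (w.1.adicCompletion E))).toBlocks₂₁).map π.symm := by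
      rw [hX, hU', Matrix.fromBlocks_map, Matrix.toBlocks_fromBlocks₂₁]
    rw [hU', hX', Matrix.fromBlocks_map, Matrix.map_one _ (map_zero _) (map_one _), Matrix.map_zero _ (map_zero _)]
  -- the factorisation over `E ⊗ F_v`
  have hfacS : adapt (matA F E c v n k) = P * U := by
    apply hinj
    change (adapt (matA F E c v n k)).map _ = (P * U).map _
    have h2 : Matrix.reindex (e₂ n).symm (e₂ n).symm
        ((p' : Matrix (Fin (n + n)) (Fin (n + n)) (w.1.adicCompletion E)) * (u' : Matrix (Fin (n + n)) (Fin (n + n)) (w.1.adicCompletion E))) =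
        (adapt (matA F E c v n k)).map (Pi.evalRingHom (fun w' : PlacesOver E v => w'.1.adicCompletion E) w) := by
      rw [← Units.val_mul, ← hfac, coe_adComp, Matrix.reindex_apply, Matrix.reindex_apply, ← Matrix.submatrix_map,
        Matrix.submatrix_submatrix, Equiv.symm_symm, Equiv.symm_comp_self, Matrix.submatrix_id_id]
    rw [← h2, Matrix.map_mul, hPπ, hUπ]
    simp only [Matrix.reindex_apply, Equiv.symm_symm, Matrix.submatrix_mul_equiv]
  -- unitarity of the factors
  have hkU := cstar_adapt_mul_antidiag_mul_adapt (cstar_matA F E c v n hJD k)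
  rw [hfacS, hPshape, hUshape] at hkU
  have hPu := cstar_blockUpper_of_mul (conjLocal E c v) _ hkU
  have hXs := cstar_lowerUnip_of_mul (conjLocal E c v) _ hkU
  have hUu := cstar_upperUnip_of_skew (conjLocal E c v) _ hXs
  -- invertibility
  have hPdet : IsUnit (Matrix.fromBlocks A B 0 D).det := by
    have e1 : Matrix.fromBlocks A B 0 D = (π.symm : w.1.adicCompletion E →+* LocalRing E v).mapMatrix
        (Matrix.reindex (e₂ n).symm (e₂ n).symm (p' : Matrix (Fin (n + n)) (Fin (n + n)) (w.1.adicCompletion E))) := by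
      rw [← hPshape, hP, RingHom.mapMatrix_apply, RingEquiv.coe_toRingHom]
    rw [e1, ← RingHom.map_det, Matrix.det_reindex_self]
    exact ((Matrix.isUnit_iff_isUnit_det _).1 (Units.isUnit p')).map _
  have hUdet : IsUnit (Matrix.fromBlocks (1 : Matrix (Fin n) (Fin n) (LocalRing E v)) X 0 1).det := by
    rw [Matrix.det_fromBlocks_zero₂₁, Matrix.det_one, mul_one]; exact isUnit_one
  -- the elements
  refine ⟨ofAdapted F E c v n hJD _ hPdet hPu, ofAdapted F E c v n hJD _ hUdet hUu, ?_,
    isSiegelDelta_ofAdapted_fromBlocks F E c hcδ hδ hd v n hT₀ hJD _ _ _ hPdet hPu,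
    isSiegelDelta_ofAdapted_fromBlocks F E c hcδ hδ hd v n hT₀ hJD _ _ _ hUdet hUu, ?_, ?_⟩
  · -- `k = p · (w u w⁻¹)`
    rw [weylDelta_inv]
    apply matA_injective F E c v n
    rw [← matA_mul, ← matA_mul, ← matA_mul, matA_ofAdapted, matA_ofAdapted, weylDelta, matA_ofAdapted,
      ← cayR_mul_adapt_mul_cayRinv (matA F E c v n k), hfacS, hPshape, hUshape, ← weylAd_mul_upperUnip_mul_weylAd n X]
    simp only [Matrix.mul_assoc]
    rw [← Matrix.mul_assoc (cayRinv _ _) (cayR _ _), cayRinv_mul_cayR, Matrix.one_mul,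
      ← Matrix.mul_assoc (cayRinv _ _) (cayR _ _), cayRinv_mul_cayR, Matrix.one_mul,
      ← Matrix.mul_assoc (cayRinv _ _) (cayR _ _), cayRinv_mul_cayR, Matrix.one_mul]
  · -- `p_w = R p' R⁻¹`
    refine ⟨p', hp'K, Units.ext ?_⟩
    rw [coe_ofAdapted_apply, ← hPshape, hPw, Units.val_mul, Units.val_mul]
  · -- `u_w = (R s) u' (R s)⁻¹`
    refine ⟨u', hu'K, Units.ext ?_⟩
    have hs : (Matrix.reindex (e₂ n) (e₂ n) (Matrix.fromBlocks (1 : Matrix (Fin n) (Fin n) (LocalRing E v)) X 0 1)).map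
        (Pi.evalRingHom (fun w' : PlacesOver E v => w'.1.adicCompletion E) w) =
        (toGLw F E v n w (weylGL F E v n) : Matrix (Fin (n + n)) (Fin (n + n)) (w.1.adicCompletion E)) *
          (u' : Matrix (Fin (n + n)) (Fin (n + n)) (w.1.adicCompletion E)) *
          ((toGLw F E v n w (weylGL F E v n))⁻¹ : GL (Fin (n + n)) (w.1.adicCompletion E)) := by
      rw [← weylAd_mul_lowerUnip_mul_weylAd, ← hUshape, reindex_mul, reindex_mul, Matrix.map_mul, Matrix.map_mul, hUw]
      rfl
    rw [coe_ofAdapted_apply, hs, _root_.mul_inv_rev, Units.val_mul, Units.val_mul, Units.val_mul, Units.val_mul]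
    simp only [Matrix.mul_assoc]

/-! ### Build-lane note (ops-buildfix G11b-3 recipe, LEDGER B13-1, 2026-08-21)
`lean -o` (the hub build lane, never `lean`/the gate check) runs Lean 4.32's library-suggestion indexers
(`Lean.LibrarySuggestions.SymbolFrequency` / `SineQuaNon`, from their `exportEntriesFn`) over the statement of
every local theorem that is not a denied premise; on this family's statements (very large dependent binder
telescopes through the theta-kernel / dual-pair data) that fold runs for tens of minutes to hours and the build
lane kills the job (incident G11b-3, run/shared/lean/ops/buildfix/G11b-3-DOSSIER.md). `isDeniedPremise` skips
`[implicit_reducible]` constants before any fold, and a reducibility status on a *theorem* is inert (Meta never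
unfolds `thmInfo`; the kernel ignores the attribute), so the public theorems of this file are tagged
`[implicit_reducible]` purely to keep them out of that index. Only other effect: they are not offered by
`+suggestions` premise selectors. No statement or proof is changed; superseded if the operator lands a
deny-list form (`HarnessLib.PremiseIndex`). -/
set_option allowUnsafeReducibility true in
attribute [implicit_reducible]
  reindex_mem_local matA_ofMat coe_component_eq_matS_map matS_ofMat coe_ofMat_apply matA_injective
  isSiegelDelta_iff_blkC_eq_zero matA_ofAdapted adapt_matA_ofAdapted blkC_eq_toBlocks₂₁_adapt
  isSiegelDelta_ofAdapted_fromBlocks LocalRing.evalEquiv_apply LocalRing.coe_evalEquiv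
  isUnit_det_weylAd weylDelta_mul_self weylDelta_inv reindex_matA coe_adComp continuous_adComp
  adComp_one adComp_mem_congruenceGL_mem_nhds lab_inl lab_inr weylAd_mul_upperUnip_mul_weylAd
  toBlocks₂₁_eq_zero_of_blockTriangular reindex_eq_fromBlocks_of_mem_unipotentRadicalGL
  coe_ofAdapted_apply exists_factorisation

end Literature.NumberTheory.GelbartRogawski1991.UnitaryDualPair.LocalSplitting

end
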